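import Summits.FinalStateConjecture.FinalStateConjecture.Theorems.ZeroEnergyKerrOrBombStationaryLimitReductionRecutCoveringJunctionCore
import Literature.Geometry.Lorentzian.CausalFutureProofs
import HarnessLib

/-!
# Route ZeroEnergyKerrOrBomb · crux `FinalStateFromKerrOrBomb` (stmt-FinalStateConjecture-17839), line `SketchIdeator1` —
# stub `stub_recutJunctionCoreB` (m5, boost-honest junction core), wave 8: the ASSEMBLY (Step 0 with the PROPORTIONAL level
# shift `τ₂ := τ₁/(2γ_max)`, Step T) of the core from its bricks

Helper file (`--supports stmt-FinalStateConjecture-17839`; registered helpers `recutJunction_holeSteer`,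
`recutJunctionCoreB_of_bricks`) of the lead's wave-8 stub worker W21 (2026-08-17). Plan `work/stubs/W17-boost-audit.md` §7.2 (Steps 0 / T); report `work/stubs/W21-report.md`
(the kernel-checked glue from ALL registered brick texts to the text of `SigM.stub_recutJunctionCoreB` is
`work/stubs/w21/ComposeCheck.lean`). Companions: `…RecutCoreBFlatSteer.lean`, `…RecutCoreBFlatSteer2.lean` (Step F,
`recutJunction_flatSteer_boost`, whose conclusion enters here as a hypothesis).

`recutJunction_holeSteer` (§2): ingredient (α) in its `r ≥ r₊ + δ` form (p141985) and the near-horizon steering (NH′, p153531)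
merge into ONE steering statement per hole: a certified late Kerr–Schild point `x` of hole `i` with `x⁰ ≤ τ₁`, `r(x) ≤ R'ᵢ τ₁`
and `r₊ + 1 ≤ R'ᵢ τ₁` has its chart point in `J⁻(recutCertifiedSlab … R' τ₁)` (case split at the (NH′) radius).

Statement (`recutJunctionCoreB_of_bricks`, §3): the conclusion of `SigM.stub_recutJunctionCoreB` VERBATIM, over a general spacetime
`𝓢` and region `O`, from the sub-list of its binders that the assembly consumes — monotone radii `Rᵢ → ∞`, the BOUNDED overlap
shell (iii-bdd), the exhaustiveness clause (ii) (source `O ∩ I⁻(docCharted d)`), Kerr identifications, the certified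
no-double clause (b_R) — plus `cᵢ = 1` (p144329), orthochrony `γᵢ := (Λᵢ e₀)⁰ ≥ 1` (p153600), and three brick conclusions as
hypotheses: B1a (lab time of rest-certified coordinates `= γᵢ t ± ε t`, eventually in the rest time `t`; p153600), the merged
hole steering ((α) p141985 + (NH′) p153531, `recutJunction_holeSteer`) and Step F (`recutJunction_flatSteer_boost`).

Proof (W17 §7.2, NO isochrony). Fix `s, W ≥ 0`, `R'ᵢ τ = Rᵢ(τ − s) − W`, the tilt/radius bound `L`, `γm := max γᵢ ⊔ 1`, the
Step F constants `(K, τC)`. For `τ₁ > τJ := 4 γm T₀ + 4(K + L + 1)` put `τ₂ := τ₁/(2γm)` (so `2T₀ ≤ τ₂ ≤ τ₁/2`,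
`(γm + ½) τ₂ ≤ τ₁ − K − 1`, `τ₂ + L < τ₁`) and apply clause (ii) at `τ₂` to `p ∈ O ∩ I⁻(docCharted d)` outside
`Ω := recutCertifiedLate … R' τ₁`: (1) `p = Ψ₀ y`, `τ₂ < y⁰ ≤ τ₁`: Step F (original point, `p ∉ Ω`); (2) `p ≤ Ψ₀ z`, `z⁰ = τ₂`:
Step F for `z` (intermediate point, `z⁰ ≤ τ₁ − K`) and transitivity; (3) `p = ψᵢ x` in an old d.o.c. tube after `τ₂` / (4)
`p ≤ ψᵢ x`, `x` an old d.o.c. slab point at `τ₂`: the hole-point steering (Step T) — with Kerr–Schild data `u`, `(Θᵢ u)⁰ = σ`: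
(T1) `u⁰ ≤ τ₁ ∧ r(u) ≤ R'ᵢ τ₁`: merged hole steering; (T2) `u⁰ > τ₁ ∧ r(u) ≤ R'ᵢ(u⁰)`: `ψᵢ x ∈ Ω` — excluded, resp. impossible
for `σ ≤ τ₂` (`u⁰ ≤ σ + L < τ₁`); (T3) else `Aᵢ.radius > Rᵢ(σ − L − s) − W − L`, a BOUNDED-shell point at rest time `σ`, so
((iii-bdd)) `ψᵢ x = Ψ₀ x'` with `x'` lab-late, `x' = x` as coordinates ((b_R)), lab time `x⁰ ∈ [σ/2, (γm + ½)σ]` (B1a with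
`ε = ½`, `γᵢ ≥ 1`); if `x⁰ > τ₁` the event is in `Ω` — excluded, resp. impossible for `σ ≤ τ₂` —, else Step F for `x'`
(`x⁰ ≥ σ/2 ≥ τ₂/2 ≥ τC`; side condition `Ψ₀ x' = p ∉ Ω`, resp. `x⁰ ≤ (γm + ½)τ₂ ≤ τ₁ − K`).

Elementary; no named fact, nothing restated. References: O'Neill 1983, Ch. 14, pp. 402–403; Dafermos–Luk arXiv:1710.01722,
Conjecture 1 (b)–(c) (late-time multi-chart bookkeeping; formalisation-internal).
-/

set_option linter.dupNamespace false
set_option maxSynthPendingDepth 3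

noncomputable section

open scoped Manifold ContDiff Topology
open Set Filter Function

namespace Summit.FinalStateConjecture.FinalStateConjecture.Theorems.SymplecticDualOfTheBomb

open Literature.Geometry.Lorentzian Summit.FinalStateConjecture.FinalStateConjecture.Theorems.OneLockedExplosion

/-! ## §1 Private copies (sibling modules unbuilt today) -/

section Causal

variable {E : Type*} [NormedAddCommGroup E] [NormedSpace ℝ E] {H : Type*} [TopologicalSpace H]
  {I : ModelWithCorners ℝ E H} {n : ℕ∞ω} {M : Type*} [TopologicalSpace M] [ChartedSpace H M]
  [IsManifold I ∞ M] {g : LorentzianMetric I n M} {τ : TimeOrientation g}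

/-- A point of `J⁻(S)` is in `J⁻` of a single point of `S`. O'Neill 1983, Ch. 14, p. 403. [folklore] -/
private theorem exists_mem_causalPast_singleton_w8 {S : Set M} {p : M} (hp : p ∈ g.causalPast τ S) :
    ∃ q ∈ S, p ∈ g.causalPast τ ({q} : Set M) := by
  -- private copy of `exists_mem_causalPast_singleton_of_mem_causalPast` (…RecutJunctionCore, unbuilt today)
  rcases hp with hp | ⟨q, hq, h⟩
  · exact ⟨p, hp, LorentzianMetric.subset_causalPast g τ _ (mem_singleton p)⟩
  · exact ⟨q, hq, Or.inr ⟨q, mem_singleton q, h⟩⟩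

/-- Transitivity of `J⁻` for sets, `T ⊆ J⁻(S) ⟹ J⁻(T) ⊆ J⁻(S)` (`C²` metric, no boundary). O'Neill 1983, Ch. 14, p. 402.
[folklore] -/
private theorem causalPast_subset_causalPast_of_subset_w8' [BoundarylessManifold I M] (hn : 2 ≤ n) {S T : Set M}
    (hT : T ⊆ g.causalPast τ S) : g.causalPast τ T ⊆ g.causalPast τ S := fun p hp ↦ by
  -- private copy of `causalPast_subset_causalPast_of_subset` (…RecutJunctionCore, unbuilt today)
  have h : p ∈ g.causalFuture τ.reverse (g.causalFuture τ.reverse S) := LorentzianMetric.causalFuture_mono hT hp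
  rwa [LorentzianMetric.causalFuture_causalFuture_eq hn S] at h

end Causal

section Copies

variable {𝓢 : Spacetime.{0} 4} {O : Set 𝓢.carrier} {k : ℕ}
  (d : StationaryFinalStateDecomposition 𝓢 O k) {M a c r₀ : Fin d.N → ℝ} {Θ : Fin d.N → E4 → E4}

/-- Two-sided radius comparison `r(u) ≤ A.radius (Θ u) + L₂` on the Kerr exterior. [folklore] -/
private theorem radius_le_adaptedRadius_add_w8' {𝓑 : StationaryAFBlackHole.{0}} {A : 𝓑.AdaptedChart}
    {M a c r₀ : ℝ} {Θ : E4 → E4} (h : IsKerrChartedWith 𝓑 A M a c r₀ Θ) :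
    ∃ L₂ : ℝ, 0 ≤ L₂ ∧ ∀ u ∈ (Kerr.exterior M a : Set E4), Kerr.radius a u ≤ A.radius (Θ u) + L₂ := by
  -- private copy of `kerrChartedWith_radius_le_adaptedRadius_add` (…RecutCoreCOFlatSteer, p146004, unbuilt today)
  obtain ⟨hsub, -, -, -, -, -, -, -, -, -, L, hL⟩ := h
  obtain ⟨C, hC⟩ := A.exists_abs_radius_sub_spatialNorm_le
  have hrp : 0 < Kerr.rPlus M a := hsub.pos.trans_le (le_add_of_nonneg_right (Real.sqrt_nonneg _))
  refine ⟨|L| + |C| + Kerr.rPlus M a + 1, by positivity, fun u hu ↦ ?_⟩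
  by_cases hfar : Kerr.rPlus M a + 1 ≤ Kerr.radius a u
  · have h1 := (abs_le.1 (hL u hu hfar).2.1).1
    linarith [le_abs_self L, abs_nonneg C]
  · have h1 := (abs_le.1 (hC (Θ u))).1
    have h2 : 0 ≤ E4.spatialNorm (Θ u) := E4.spatialNorm_nonneg _
    linarith [le_abs_self C, abs_nonneg L, not_le.1 hfar]

/-- A d.o.c.-part coordinate of hole `i` has Kerr–Schild coordinates. [folklore] -/
private theorem exists_kerr_of_mem_docPart_w8' {i : Fin d.N}
    (hW : IsKerrChartedWith (d.hole i) (d.adapted i) (M i) (a i) (c i) (r₀ i) (Θ i))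
    {y : (d.background i).domain} (hy : y ∈ docPart d i) :
    ∃ x ∈ (Kerr.exterior (M i) (a i) : Set E4), Θ i x = poincareInv (d.motion i).1 (d.motion i).2 y.1 := by
  -- private copy of `exists_kerr_of_mem_docPart` (…RecutCoreCOFlatSteer, p146004, unbuilt today)
  have h : poincareInv (d.motion i).1 (d.motion i).2 y.1 ∈ Θ i '' (Kerr.exterior (M i) (a i) : Set E4) := by
    rw [hW.2.2.2.2.2.2.2.2.2.1]; exact hy
  obtain ⟨x, hx, hxy⟩ := h
  exact ⟨x, hx, hxy⟩

/-- Membership in the recut certified tube from the Kerr–Schild data (`x⁰ > τ₁`, `r(x) ≤ R'ᵢ x⁰`). [folklore] -/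
private theorem chart_mem_recutCertifiedLate_of_kerr_w8' {i : Fin d.N} (R' : Fin d.N → ℝ → ℝ) {τ₁ : ℝ}
    {x : E4} (hx : x ∈ (Kerr.exterior (M i) (a i) : Set E4)) (hx0 : τ₁ < x 0)
    (hxr : Kerr.radius (a i) x ≤ R' i (x 0))
    (h₀ : ((d.motion i).1 : E4 ≃L[ℝ] E4) (Θ i x) + (d.motion i).2 ∈ (d.background i).domain) :
    d.toOver.chart i ⟨((d.motion i).1 : E4 ≃L[ℝ] E4) (Θ i x) + (d.motion i).2, h₀⟩ ∈
      recutCertifiedLate d M a Θ R' τ₁ := by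
  -- private copy of `chart_mem_recutCertifiedLate_of_kerr` (…RecutCoreCOFlatSteer, p146004, unbuilt today)
  set z : E4 := ((d.motion i).1 : E4 ≃L[ℝ] E4) x + (d.motion i).2 with hz
  have hPz : poincareInv (d.motion i).1 (d.motion i).2 z = x := poincareInv_apply_add _ _ _
  have hzdom : z ∈ ((recutBackground d M a i).domain : Set E4) := by
    show poincareInv (d.motion i).1 (d.motion i).2 z ∈ (Kerr.exterior (M i) (a i) : Set E4)
    rw [hPz]; exact hx
  refine Or.inr (mem_iUnion.2 ⟨i, mem_image_of_mem _ ?_⟩)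
  refine ⟨z, ⟨⟨z, hzdom⟩, ⟨?_, ?_⟩, rfl⟩, ?_⟩
  · show τ₁ < (poincareInv (d.motion i).1 (d.motion i).2 z) 0
    rw [hPz]; exact hx0
  · show Kerr.radius (a i) (poincareInv (d.motion i).1 (d.motion i).2 z) ≤
      R' i ((poincareInv (d.motion i).1 (d.motion i).2 z) 0)
    rw [hPz]; exact hxr
  · show ((d.motion i).1 : E4 ≃L[ℝ] E4) (Θ i (poincareInv (d.motion i).1 (d.motion i).2 z)) + (d.motion i).2 = _
    rw [hPz]

end Copies

/-! ## §2 The hole-steering adapter: (α) for `r ≥ r₊ + δ` and (NH′) below, merged -/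

/-- **Registered helper `recutJunction_holeSteer`**: from the conclusions of ingredient (α) (`r ≥ r₊ + δ` form, p141985) and of
the boost-general near-horizon steering (NH′, p153531): for every hole `i` there is a rest time `T` such that every
Kerr–Schild point `x ∈ Kerr.exterior` with `(Θᵢ x)⁰ ≥ T`, certified `Aᵢ.radius (Θᵢ x) ≤ Rᵢ((Θᵢ x)⁰)`, `x⁰ ≤ τ₁`,
`r(x) ≤ R'ᵢ τ₁` and `r₊ + 1 ≤ R'ᵢ τ₁` has its chart point in `J⁻(recutCertifiedSlab d M a Θ R' τ₁)`. [folklore] -/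
theorem recutJunction_holeSteer : ∀ {𝓢 : Spacetime.{0} 4} {O : Set 𝓢.carrier} {k : ℕ} (d : StationaryFinalStateDecomposition 𝓢 O k) (M a : Fin d.N → ℝ) (Θ : Fin d.N → E4 → E4) (R : Fin d.N → ℝ → ℝ), (∀ (i : Fin d.N) (δ : ℝ), 0 < δ → ∃ T : ℝ, ∀ (R' : Fin d.N → ℝ → ℝ) (τ₁ : ℝ), ∀ x ∈ (Kerr.exterior (M i) (a i) : Set E4), Kerr.rPlus (M i) (a i) + δ ≤ Kerr.radius (a i) x → T ≤ Θ i x 0 → (d.adapted i).radius (Θ i x) ≤ R i (Θ i x 0) → x 0 ≤ τ₁ → Kerr.radius (a i) x ≤ R' i τ₁ → ∀ h₀ : ((d.motion i).1 : E4 ≃L[ℝ] E4) (Θ i x) + (d.motion i).2 ∈ (d.background i).domain, d.toOver.chart i ⟨((d.motion i).1 : E4 ≃L[ℝ] E4) (Θ i x) + (d.motion i).2, h₀⟩ ∈ 𝓢.metric.causalPast 𝓢.timeOrientation (recutCertifiedSlab d M a Θ R' τ₁)) → (∀ i : Fin d.N, ∃ δ T : ℝ, 0 < δ ∧ ∀ (R'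 : Fin d.N → ℝ → ℝ) (τ₁ : ℝ), ∀ x ∈ (Kerr.exterior (M i) (a i) : Set E4), Kerr.radius (a i) x < Kerr.rPlus (M i) (a i) + δ → T ≤ Θ i x 0 → (d.adapted i).radius (Θ i x) ≤ R i (Θ i x 0) → x 0 ≤ τ₁ → Kerr.rPlus (M i) (a i) + 1 ≤ R' i τ₁ → ∀ h₀ : ((d.motion i).1 : E4 ≃L[ℝ] E4) (Θ i x) + (d.motion i).2 ∈ (d.background i).domain, d.toOver.chart i ⟨((d.motion i).1 : E4 ≃L[ℝ] E4) (Θ i x) + (d.motion i).2, h₀⟩ ∈ 𝓢.metric.causalPast 𝓢.timeOrientation (recutCertifiedSlab d M a Θ R' τ₁)) → ∀ i : Fin d.N, ∃ T : ℝ, ∀ (R' : Fin d.N → ℝ → ℝ) (τ₁ : ℝ), ∀ x ∈ (Kerr.exterior (M i) (a i) : Set E4), T ≤ Θ i x 0 → (d.adapted i).radius (Θ i x) ≤ R i (Θ i x 0) → x 0 ≤ τ₁ → Kerr.radius (a i) x ≤ R' i τ₁ → Kerr.rPlus (M i) (a i) + 1 ≤ R' i τ₁ → ∀ h₀ : ((d.motion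 i).1 : E4 ≃L[ℝ] E4) (Θ i x) + (d.motion i).2 ∈ (d.background i).domain, d.toOver.chart i ⟨((d.motion i).1 : E4 ≃L[ℝ] E4) (Θ i x) + (d.motion i).2, h₀⟩ ∈ 𝓢.metric.causalPast 𝓢.timeOrientation (recutCertifiedSlab d M a Θ R' τ₁) := by
  intro 𝓢 O k d M a Θ R hα hNH i
  obtain ⟨δ, TN, hδ, hTN⟩ := hNH i
  obtain ⟨Tα, hTα⟩ := hα i δ hδ
  refine ⟨max Tα TN, fun R' τ₁ x hx hT hAR hx0 hxr hgrow h₀ ↦ ?_⟩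
  by_cases hr : Kerr.rPlus (M i) (a i) + δ ≤ Kerr.radius (a i) x
  · exact hTα R' τ₁ x hx hr ((le_max_left _ _).trans hT) hAR hx0 hxr h₀
  · exact hTN R' τ₁ x hx (not_le.1 hr) ((le_max_right _ _).trans hT) hAR hx0 hgrow h₀

/-! ## §3 The assembly -/

/-- **Registered helper `recutJunctionCoreB_of_bricks` (the boost-honest junction core from its bricks; Step 0 with the
proportional level shift `τ₂ := τ₁/(2γ_max)` and Step T).** See the module docstring for hypotheses, conclusion (the conclusion
of `SigM.stub_recutJunctionCoreB` verbatim) and proof. Dafermos–Luk arXiv:1710.01722, Conjecture 1 (b)–(c). [folklore] -/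
theorem recutJunctionCoreB_of_bricks : ∀ {𝓢 : Spacetime.{0} 4} {O : Set 𝓢.carrier} {k : ℕ} (d : StationaryFinalStateDecomposition 𝓢 O k) (M a c r₀ : Fin d.N → ℝ) (Θ : Fin d.N → E4 → E4) (R : Fin d.N → ℝ → ℝ), (∀ i, Monotone (R i)) → (∀ i, Tendsto (R i) atTop atTop) → (∀ i, ∀ W s₀ : ℝ, ∀ᶠ σ in atTop, d.toOver.chart i '' ({x | (d.background i).time x.1 = σ ∧ R i (σ - s₀) - W ≤ (d.background i).radius x.1 ∧ (d.background i).radius x.1 ≤ R i σ} ∩ docPart d i) ⊆ d.toOver.radiationZone) → (∀ τ₁ : ℝ, d.toOver.τ₀ < τ₁ → (O ∩ 𝓢.metric.chronologicalPast 𝓢.timeOrientation (docCharted d)) \ docCertifiedLate d R τ₁ ⊆ 𝓢.metric.causalPast 𝓢.timeOrientation (docCertifiedSlab d R τ₁)) → (∀ i, IsKerrChartedWith (d.hole i) (d.adapted i) (M i) (a i) (c i) (r₀ i) (Θ i)) → (∀ i, c i = 1) → (∀ i : Fin d.N, 1 ≤ ((d.motion i).1 : E4 ≃L[ℝ] E4)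 (E4.basisVector 0) 0) → (∀ (i : Fin d.N) (y : (d.background i).domain) (y' : d.toOver.flatDomain), d.toOver.τ₀ < (d.background i).time y.1 → (d.background i).radius y.1 ≤ R i ((d.background i).time y.1) → d.toOver.τ₀ < (y' : E4) 0 → d.toOver.chart i y = d.toOver.flatChart y' → (y : E4) = y') → (∀ (i : Fin d.N) (ε : ℝ), 0 < ε → ∀ᶠ t in atTop, ∀ y : E4, (d.background i).time y = t → (d.background i).radius y ≤ R i t → |y 0 - ((d.motion i).1 : E4 ≃L[ℝ] E4) (E4.basisVector 0) 0 * t| ≤ ε * t) → (∀ i : Fin d.N, ∃ T : ℝ, ∀ (R' : Fin d.N → ℝ → ℝ) (τ₁ : ℝ), ∀ x ∈ (Kerr.exterior (M i) (a i) : Set E4), T ≤ Θ i x 0 → (d.adapted i).radius (Θ i x) ≤ R i (Θ i x 0) → x 0 ≤ τ₁ → Kerr.radius (a i) x ≤ R' i τ₁ → Kerr.rPlus (M i) (a i) + 1 ≤ R' i τ₁ → ∀ h₀ : ((d.motion i).1 : E4 ≃L[ℝ] E4) (Θ i x) + (d.motion i).2 ∈ (d.background i).domain, d.toOver.chart i ⟨((d.motion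 i).1 : E4 ≃L[ℝ] E4) (Θ i x) + (d.motion i).2, h₀⟩ ∈ 𝓢.metric.causalPast 𝓢.timeOrientation (recutCertifiedSlab d M a Θ R' τ₁)) → (∀ s W : ℝ, 0 ≤ s → 0 ≤ W → ∃ K τC : ℝ, 0 ≤ K ∧ d.toOver.τ₀ < τC ∧ ∀ (τ₁ : ℝ) (y : d.toOver.flatDomain), τC ≤ (y : E4) 0 → (y : E4) 0 ≤ τ₁ → (d.toOver.flatChart y ∉ recutCertifiedLate d M a Θ (fun i τ ↦ R i (c i * τ - s) - W) τ₁ ∨ (y : E4) 0 ≤ τ₁ - K) → d.toOver.flatChart y ∈ 𝓢.metric.causalPast 𝓢.timeOrientation (recutCertifiedSlab d M a Θ (fun i τ ↦ R i (c i * τ - s) - W) τ₁)) → ∃ s₁ : ℝ, ∀ s W : ℝ, s₁ ≤ s → s₁ ≤ W → ∃ τJ : ℝ, ∀ τ₁ : ℝ, τJ < τ₁ → ((𝓢.metric.causalPast 𝓢.timeOrientation (docHoleSlabs d R τ₁) ∪ docHoleTubes d R τ₁) ∩ (O ∩ 𝓢.metric.chronologicalPast 𝓢.timeOrientation (docCharted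 d))) \ recutCertifiedLate d M a Θ (fun i τ ↦ R i (c i * τ - s) - W) τ₁ ⊆ 𝓢.metric.causalPast 𝓢.timeOrientation (recutCertifiedSlab d M a Θ (fun i τ ↦ R i (c i * τ - s) - W) τ₁) := by
  intro 𝓢 O k d M a c r₀ Θ R hRmono hRtop hRiii hRii hW hc1 hγ hRb hB1a hHS hCF
  refine ⟨0, fun s W hs hWge ↦ ?_⟩
  -- the transported radii, read with `cᵢ = 1`
  set R' : Fin d.N → ℝ → ℝ := fun i τ ↦ R i (c i * τ - s) - W with hR'_def
  have hR' : ∀ i τ, R' i τ = R i (τ - s) - W := fun i τ ↦ by simp [hR'_def, hc1 i]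
  have h2le : (2 : ℕ∞ω) ≤ ((⊤ : ℕ∞) : ℕ∞ω) := WithTop.coe_le_coe.mpr le_top
  -- constants of the identifications: tilt / radius comparison `L`
  have hglob := fun i ↦ kerrChartedWith_global_bounds (hW i)
  choose L₁ hL₁0 hL₁ using hglob
  have hrad := fun i ↦ radius_le_adaptedRadius_add_w8' (hW i)
  choose L₂ hL₂0 hL₂ using hrad
  obtain ⟨L', hL'⟩ := Finite.exists_le fun i ↦ max (L₁ i) (L₂ i)
  set L : ℝ := max L' 0 with hL_def
  have hL0 : 0 ≤ L := le_max_right _ _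
  have htilt : ∀ i, ∀ u ∈ (Kerr.exterior (M i) (a i) : Set E4), |Θ i u 0 - u 0| ≤ L := fun i u hu ↦ by
    have h := (hL₁ i u hu).1
    rw [hc1 i, one_mul] at h
    exact h.trans ((le_max_left _ _).trans ((hL' i).trans (le_max_left _ _)))
  have hradle : ∀ i, ∀ u ∈ (Kerr.exterior (M i) (a i) : Set E4),
      Kerr.radius (a i) u ≤ (d.adapted i).radius (Θ i u) + L := fun i u hu ↦ by
    have h1 : L₂ i ≤ L := (le_max_right _ _).trans ((hL' i).trans (le_max_left _ _))
    linarith [hL₂ i u hu]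
  -- the maximal Lorentz factor `γm ≥ 1`
  obtain ⟨γm', hγm'⟩ := Finite.exists_le fun i : Fin d.N ↦ ((d.motion i).1 : E4 ≃L[ℝ] E4) (E4.basisVector 0) 0
  set γm : ℝ := max γm' 1 with hγm_def
  have hγm1 : 1 ≤ γm := le_max_right _ _
  have hγi : ∀ i, ((d.motion i).1 : E4 ≃L[ℝ] E4) (E4.basisVector 0) 0 ≤ γm := fun i ↦
    (hγm' i).trans (le_max_left _ _)
  -- the steering data: merged hole steering, Step F
  choose Ths hThs using hHS
  obtain ⟨K, τC, hK0, hτC, hF⟩ := hCF s W hs hWge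
  -- clause (iii-bdd) with margins `(W + L, s + L)`, B1a with `ε = 1/2`, growth of the radii
  have hiii' := fun i ↦ eventually_atTop.1 ((hRiii i (W + L) (s + L)).and (eventually_gt_atTop d.toOver.τ₀))
  choose Sg hSg using hiii'
  have hB1a' := fun i ↦ eventually_atTop.1 (hB1a i (1 / 2) (by norm_num))
  choose Sb hSb using hB1a'
  have hgrow := fun i ↦ eventually_atTop.1 ((hRtop i).eventually_ge_atTop (Kerr.rPlus (M i) (a i) + 1 + W))
  choose TR hTR using hgrow
  obtain ⟨T₁, hT₁⟩ := Finite.exists_le fun i ↦ max (max (Sg i) (Sb i)) (max (TR i + s) (Ths i))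
  set T₀ : ℝ := max (max τC (d.toOver.τ₀ + 1)) (max T₁ 0) with hT₀
  have hT₀C : τC ≤ T₀ := (le_max_left _ _).trans (le_max_left _ _)
  have hT₀τ : d.toOver.τ₀ + 1 ≤ T₀ := (le_max_right _ _).trans (le_max_left _ _)
  have hT₀1 : T₁ ≤ T₀ := (le_max_left _ _).trans (le_max_right _ _)
  have hT₀0 : 0 ≤ T₀ := (le_max_right _ _).trans (le_max_right _ _)
  refine ⟨4 * γm * T₀ + 4 * (K + L + 1), fun τ₁ hτ₁ ↦ ?_⟩
  have hi1 : ∀ i, Sg i ≤ T₁ ∧ Sb i ≤ T₁ ∧ TR i + s ≤ T₁ ∧ Ths i ≤ T₁ := fun i ↦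
    ⟨(le_max_left _ _).trans ((le_max_left _ _).trans (hT₁ i)),
      (le_max_right _ _).trans ((le_max_left _ _).trans (hT₁ i)),
      (le_max_left _ _).trans ((le_max_right _ _).trans (hT₁ i)),
      (le_max_right _ _).trans ((le_max_right _ _).trans (hT₁ i))⟩
  -- the shifted level `τ₂ := τ₁ / (2 γm)`
  have h4 : 0 ≤ 4 * γm * T₀ := by positivity
  have hτ₁0 : 0 < τ₁ := by linarith
  set τ₂ : ℝ := τ₁ / (2 * γm) with hτ₂
  have hτ₂eq : τ₂ * (2 * γm) = τ₁ := by rw [hτ₂]; field_simp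
  have hτ₂a : 2 * T₀ ≤ τ₂ := by
    rw [hτ₂, le_div_iff₀ (by positivity)]; linarith
  have hτ₂0 : 0 ≤ τ₂ := by linarith
  have hτ₂b : τ₂ * 2 ≤ τ₁ := by nlinarith [mul_nonneg hτ₂0 (sub_nonneg.2 hγm1), hτ₂eq]
  have hτ₂c : (γm + 1 / 2) * τ₂ ≤ τ₁ - K - 1 := by linarith [hτ₂eq, hτ₂b]
  have hτ₂L : τ₂ + L < τ₁ := by linarith
  have hτ₂τ₀ : d.toOver.τ₀ < τ₂ := by linarith
  -- §3: steering of a late d.o.c.-part hole coordinate in the old certified tube (Step T)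
  have holePoint : ∀ (i : Fin d.N) (y : (d.background i).domain), y ∈ docPart d i →
      τ₂ ≤ (d.background i).time y.1 →
      (d.background i).radius y.1 ≤ R i ((d.background i).time y.1) →
      (d.toOver.chart i y ∉ recutCertifiedLate d M a Θ R' τ₁ ∨ (d.background i).time y.1 ≤ τ₂) →
        d.toOver.chart i y ∈ 𝓢.metric.causalPast 𝓢.timeOrientation (recutCertifiedSlab d M a Θ R' τ₁) := by
    intro i y hydoc hyσ hyR hΩ
    obtain ⟨u, hu, hΘu⟩ := exists_kerr_of_mem_docPart_w8' d (hW i) hydoc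
    set σ : ℝ := (d.background i).time y.1 with hσ_def
    have hΘu0 : Θ i u 0 = σ := by rw [hΘu, hσ_def]; rfl
    have hσlate : d.toOver.τ₀ < σ := by linarith
    have hσ0 : 0 ≤ σ := by linarith
    obtain ⟨hu0a, hu0b⟩ := abs_le.1 (htilt i u hu)
    rw [hΘu0] at hu0a hu0b
    obtain ⟨hSg1, hSb1, hTR1, hThs1⟩ := hi1 i
    have hPy : ((d.motion i).1 : E4 ≃L[ℝ] E4) (Θ i u) + (d.motion i).2 = (y : E4) := by
      rw [hΘu, apply_poincareInv_add]
    have hAR : (d.adapted i).radius (Θ i u) ≤ R i (Θ i u 0) := by rw [hΘu0, hΘu]; exact hyR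
    have hgrow1 : Kerr.rPlus (M i) (a i) + 1 ≤ R' i τ₁ := by
      rw [hR']; linarith [hTR i (τ₁ - s) (by linarith)]
    -- (T1) the merged hole steering from the Kerr–Schild data
    have steer : u 0 ≤ τ₁ → Kerr.radius (a i) u ≤ R' i τ₁ →
        d.toOver.chart i y ∈ 𝓢.metric.causalPast 𝓢.timeOrientation (recutCertifiedSlab d M a Θ R' τ₁) := by
      intro h3 h2
      have key : ∀ y' : (d.background i).domain,
          (y' : E4) = ((d.motion i).1 : E4 ≃L[ℝ] E4) (Θ i u) + (d.motion i).2 →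
            d.toOver.chart i y' ∈ 𝓢.metric.causalPast 𝓢.timeOrientation (recutCertifiedSlab d M a Θ R' τ₁) := by
        rintro ⟨v, hv⟩ rfl
        exact hThs i R' τ₁ u hu (by rw [hΘu0]; linarith) hAR h3 h2 hgrow1 hv
      exact key ⟨(y : E4), y.2⟩ hPy.symm
    -- (T2) membership in `Ω` from the Kerr–Schild data
    have omega : τ₁ < u 0 → Kerr.radius (a i) u ≤ R' i (u 0) →
        d.toOver.chart i y ∈ recutCertifiedLate d M a Θ R' τ₁ := by
      intro h0 hr
      have key : ∀ y' : (d.background i).domain,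
          (y' : E4) = ((d.motion i).1 : E4 ≃L[ℝ] E4) (Θ i u) + (d.motion i).2 →
            d.toOver.chart i y' ∈ recutCertifiedLate d M a Θ R' τ₁ := by
        rintro ⟨v, hv⟩ rfl
        exact chart_mem_recutCertifiedLate_of_kerr_w8' d R' hu h0 hr hv
      exact key ⟨(y : E4), y.2⟩ hPy.symm
    -- (T3) bounded-shell points are flat events of controlled lab time: Step F
    have far : R i (σ - L - s) - W - L < (d.adapted i).radius (Θ i u) →
        d.toOver.chart i y ∈ 𝓢.metric.causalPast 𝓢.timeOrientation (recutCertifiedSlab d M a Θ R' τ₁) := by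
      intro hfar
      obtain ⟨hsub, -⟩ := hSg i σ (by linarith)
      have hmem : d.toOver.chart i y ∈ d.toOver.radiationZone := by
        refine hsub (mem_image_of_mem _ ⟨⟨rfl, ?_, ?_⟩, hydoc⟩)
        · show R i (σ - (s + L)) - (W + L) ≤ (d.adapted i).radius (poincareInv (d.motion i).1 (d.motion i).2 y.1)
          rw [← hΘu, show σ - (s + L) = σ - L - s by ring]
          linarith
        · exact hyR
      obtain ⟨x', hx', heq⟩ := hmem
      have hx'late : d.toOver.τ₀ < (x' : E4) 0 := hx'
      have hyx' : (y : E4) = x' := hRb i y x' hσlate hyR hx'late heq.symm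
      -- lab time of `y` from B1a (`ε = 1/2`) and `1 ≤ γᵢ ≤ γm`
      have hlab := hSb i σ (by linarith) (y : E4) rfl hyR
      obtain ⟨hl1, hl2⟩ := abs_le.1 hlab
      have hγσ : σ ≤ ((d.motion i).1 : E4 ≃L[ℝ] E4) (E4.basisVector 0) 0 * σ := le_mul_of_one_le_left hσ0 (hγ i)
      have hγσ' : ((d.motion i).1 : E4 ≃L[ℝ] E4) (E4.basisVector 0) 0 * σ ≤ γm * σ :=
        mul_le_mul_of_nonneg_right (hγi i) hσ0
      have hylo : σ / 2 ≤ (y : E4) 0 := by linarith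
      have hyhi : (y : E4) 0 ≤ (γm + 1 / 2) * σ := by linarith
      rw [← heq]
      by_cases hlate : τ₁ < (x' : E4) 0
      · -- the event is flat-late: in `Ω` — excluded, resp. impossible for `σ ≤ τ₂`
        have hΩ' : d.toOver.flatChart x' ∈ recutCertifiedLate d M a Θ R' τ₁ :=
          Or.inl (mem_image_of_mem _ (show τ₁ < (x' : E4) 0 from hlate))
        rcases hΩ with hΩ | hle
        · rw [← heq] at hΩ; exact (hΩ hΩ').elim
        · exfalso
          have h := mul_le_mul_of_nonneg_left hle (by positivity : (0 : ℝ) ≤ γm + 1 / 2)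
          rw [← hyx'] at hlate
          linarith
      · push Not at hlate
        refine hF τ₁ x' ?_ hlate ?_
        · rw [← hyx']; linarith
        · rcases hΩ with hΩ | hle
          · left; rwa [← heq] at hΩ
          · right
            rw [← hyx']
            have h := mul_le_mul_of_nonneg_left hle (by positivity : (0 : ℝ) ≤ γm + 1 / 2)
            linarith
    -- case analysis on the Kerr–Schild data
    by_cases h3 : u 0 ≤ τ₁
    · by_cases h2 : Kerr.radius (a i) u ≤ R' i τ₁
      · exact steer h3 h2
      · refine far ?_
        have hmono : R i (σ - L - s) ≤ R i (τ₁ - s) := hRmono i (by linarith)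
        rw [hR'] at h2
        linarith [hradle i u hu, not_le.1 h2]
    · push Not at h3
      by_cases h2 : Kerr.radius (a i) u ≤ R' i (u 0)
      · exact hΩ.elim (fun hΩ ↦ (hΩ (omega h3 h2)).elim) fun hle ↦ by exfalso; linarith
      · refine far ?_
        have hmono : R i (σ - L - s) ≤ R i (u 0 - s) := hRmono i (by linarith)
        rw [hR'] at h2
        linarith [hradle i u hu, not_le.1 h2]
  -- §4: the four branches of clause (ii) at the level `τ₂` (Step 0)
  rintro p ⟨⟨-, hpO⟩, hpΩ⟩
  by_cases hp2 : p ∈ docCertifiedLate d R τ₂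
  · rw [docCertifiedLate_eq] at hp2
    rcases hp2 with ⟨y, hy, rfl⟩ | hp3
    · -- (1) `p` is flat-late after `τ₂`: Step F, original point
      have hy₂ : τ₂ < (y : E4) 0 := hy
      by_cases hy₁ : τ₁ < (y : E4) 0
      · exact (hpΩ (Or.inl (mem_image_of_mem _ (show τ₁ < (y : E4) 0 from hy₁)))).elim
      · exact hF τ₁ y (by linarith) (not_lt.1 hy₁) (Or.inl hpΩ)
    · -- (3) `p` in an old d.o.c. tube after `τ₂`
      obtain ⟨i, hi⟩ := mem_iUnion.1 hp3
      obtain ⟨y, ⟨⟨hyt, hyr⟩, hydoc⟩, rfl⟩ := hi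
      exact holePoint i y hydoc hyt.le hyr (Or.inl hpΩ)
  · have hp4 := hRii τ₂ hτ₂τ₀ ⟨hpO, hp2⟩
    rw [docCertifiedSlab_eq] at hp4
    rcases causalPast_union_subset _ _ hp4 with hflat | hslab
    · -- (2) `p` below a flat slab point `q` of lab time `τ₂`: Step F, intermediate point
      obtain ⟨q, ⟨y, hy, rfl⟩, hpq⟩ := exists_mem_causalPast_singleton_w8 hflat
      have hy₂ : (y : E4) 0 = τ₂ := hy
      have hq : d.toOver.flatChart y ∈ 𝓢.metric.causalPast 𝓢.timeOrientation (recutCertifiedSlab d M a Θ R' τ₁) :=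
        hF τ₁ y (by linarith) (by linarith) (Or.inr (by linarith))
      exact causalPast_subset_causalPast_of_subset_w8' h2le (singleton_subset_iff.2 hq) hpq
    · -- (4) `p` below an old d.o.c. slab point `q` at `τ₂`
      obtain ⟨q, hq, hpq⟩ := exists_mem_causalPast_singleton_w8 hslab
      obtain ⟨i, hi⟩ := mem_iUnion.1 hq
      obtain ⟨y, ⟨⟨hyt, hyr⟩, hydoc⟩, rfl⟩ := hi
      have hyt' : (d.background i).time y.1 = τ₂ := hyt
      have hq' := holePoint i y hydoc hyt'.ge (by rw [hyt']; exact hyr) (Or.inr hyt'.le)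
      exact causalPast_subset_causalPast_of_subset_w8' h2le (singleton_subset_iff.2 hq') hpq

end Summit.FinalStateConjecture.FinalStateConjecture.Theorems.SymplecticDualOfTheBomb

end
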